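import Mathlib
import HarnessLib
import Summits.QuantumFields.YangMills.Theses.PencilRigidity
import Summits.QuantumFields.YangMills.Theorems.PencilRigidityCurvatureKernelBoundTensorRegularityPlaneWave
import Summits.QuantumFields.YangMills.Theorems.PencilRigidityCurvatureKernelBoundTensorRegularityFourier
import Literature.MathematicalPhysics.QuantumLattice.WightmanTubeLaplace

/-!
# `CurvatureKernelBound` — stub A2 `TensorRegularity`: a local kernel from pure-derivative bounds

Crux `stmt-QuantumFields-11687` (`PencilRigidity.CurvatureKernelBound`), line
`sixteen-charts-analytic-kernel`, stub `TensorRegularity` (A2, pure analysis; the elementary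
Fourier-decay form of "`WF(u) ⊂ ⋂ⱼ nⱼ^⊥ = {0}` ⇒ `u` is a function", Hörmander ALPDO I §8.1).

Let `E = ℝ⁴`, `v : Fin 4 → E` linearly independent, `U, V ⊆ E` open, `x₀ ∈ U`, `y₀ ∈ V`, `M₀ ∈ ℕ`.
There are `N₁ = 2M₀ + 9`, `ρ > 0` and `B` such that every continuous functional `Λ` on
`𝓢(E², ℂ)` with `‖Λ(∂_{vⱼ}ᴺ f ⊗ g)‖, ‖Λ(f ⊗ ∂_{vⱼ}ᴺ g)‖ ≤ |f|_{M₀} |g|_{M₀}` (`N ≤ N₁`, `supp f ⊆ U`,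
`supp g ⊆ V`) is, on test functions supported in `B(x₀, ρ) × B(y₀, ρ)`, integration against a
continuous kernel bounded by `B` (`TensorRegularity`).  Assembly:

* `exists_norm_le_mul_abs_inner` — spanning directions control the norm, `‖ξ‖ ≤ K maxⱼ |⟪ξ, vⱼ⟫|`;
* `pow_mul_le_of_slot_bounds` — the slot bounds `|⟪ξ,vⱼ⟫|ᴺ g, |⟪η,vⱼ⟫|ᴺ g ≤ D₀(1+‖ξ‖)^{M₀}(1+‖η‖)^{M₀}`
  (`N ≤ 2M₀ + k`) give `(1 + ‖ξ‖ + ‖η‖)ᵏ g ≤ (1 + 2K)^{2M₀+k} D₀`;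
* `exists_cutoff_schwartz` — bump cut-offs `χ = 1` on `B(x₀, ρ)`, `supp χ ⊆ B̄(x₀, 2ρ)`;
* the flattening `flattenCLE 3 2 : E² ≃L ℝ⁸` (tree, measure preserving) carries `Λ` to a tempered
  distribution `T` on `ℝ⁸` whose localisation `(χ₁ ⊗ χ₂)T` has plane-wave values
  `Λ(e_ξ χ₁ ⊗ e_η χ₂)` (sub-goal `PlaneWaveTensorDecay`) dominated by `A (1 + ‖a‖)⁻⁹ ∈ L¹(ℝ⁸)`, so
  `FourierDecayKernel` produces the kernel.
[folklore]
-/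

noncomputable section

open scoped SchwartzMap FourierTransform RealInnerProductSpace LineDeriv
open MeasureTheory Filter Set Real Metric
open Literature.MathematicalPhysics.QuantumLattice Literature.Analysis.FunctionSpaces

namespace Summit.QuantumFields.YangMills.Theorems.CurvatureKernel

/-! ## Geometry: spanning directions, combination of slot bounds, cut-offs -/

section Geometry

variable {E : Type*} [NormedAddCommGroup E] [InnerProductSpace ℝ E]

/-- **Spanning directions control the norm**: if `v : ι → E` is a basis (linearly independent with
`|ι| = dim E`), there is `K ≥ 0` with `‖ξ‖ ≤ K |⟪ξ, vⱼ⟫|` for some `j` depending on `ξ` (the linear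
map `ξ ↦ (⟪ξ, vⱼ⟫)ⱼ` is injective, hence antilipschitz in finite dimension). [folklore] -/
theorem exists_norm_le_mul_abs_inner [FiniteDimensional ℝ E] {ι : Type*} [Fintype ι] [Nonempty ι]
    {v : ι → E} (hv : LinearIndependent ℝ v) (hcard : Fintype.card ι = Module.finrank ℝ E) :
    ∃ K : ℝ, 0 ≤ K ∧ ∀ ξ : E, ∃ j, ‖ξ‖ ≤ K * |⟪ξ, v j⟫| := by
  let T : E →ₗ[ℝ] (ι → ℝ) :=
    { toFun := fun ξ j => ⟪ξ, v j⟫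
      map_add' := fun ξ ζ => funext fun j => inner_add_left _ _ _
      map_smul' := fun c ξ => funext fun j => by simp [real_inner_smul_left] }
  have hT : ∀ ξ j, T ξ j = ⟪ξ, v j⟫ := fun ξ j => rfl
  have hker : LinearMap.ker T = ⊥ := by
    refine LinearMap.ker_eq_bot'.2 fun ξ hξ => ?_
    have h0 : ∀ j, ⟪ξ, v j⟫ = 0 := fun j => by rw [← hT, hξ]; rfl
    set b := basisOfLinearIndependentOfCardEqFinrank hv hcard with hb
    have hbv : ⇑b = v := coe_basisOfLinearIndependentOfCardEqFinrank hv hcard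
    have hself : ⟪ξ, ∑ j, b.repr ξ j • b j⟫ = 0 := by
      rw [inner_sum]
      simp [inner_smul_right, hbv, h0]
    rw [b.sum_repr] at hself
    exact inner_self_eq_zero.1 hself
  obtain ⟨K, -, hK⟩ := T.exists_antilipschitzWith hker
  refine ⟨K, K.coe_nonneg, fun ξ => ?_⟩
  obtain ⟨j, -, hj⟩ := Finset.exists_max_image Finset.univ (fun j => |⟪ξ, v j⟫|) Finset.univ_nonempty
  refine ⟨j, ?_⟩
  have h1 : ‖ξ‖ ≤ K * ‖T ξ‖ := by
    have := hK.le_mul_dist ξ 0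
    simpa [dist_eq_norm] using this
  have h2 : ‖T ξ‖ ≤ |⟪ξ, v j⟫| :=
    (pi_norm_le_iff_of_nonneg (abs_nonneg _)).2 fun j' => by
      rw [hT, Real.norm_eq_abs]
      exact hj j' (Finset.mem_univ _)
  exact h1.trans (mul_le_mul_of_nonneg_left h2 K.coe_nonneg)

/-- **Combination of the slot bounds.** If `‖ξ‖ ≤ K|⟪ξ, v_{j₁}⟫|`, `‖η‖ ≤ K|⟪η, v_{j₂}⟫|` and
`(|⟪ξ, vⱼ⟫|ᴺ + |⟪η, vⱼ⟫|ᴺ) g ≤ D₀ (1 + ‖ξ‖)^{M₀} (1 + ‖η‖)^{M₀}` for all `j` and `N ≤ 2M₀ + k`, then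
`(1 + ‖ξ‖ + ‖η‖)ᵏ g ≤ (1 + 2K)^{2M₀ + k} D₀` (take the largest of `1`, `|⟪ξ, v_{j₁}⟫|`, `|⟪η, v_{j₂}⟫|`).
[folklore] -/
theorem pow_mul_le_of_slot_bounds {ι : Type*} {v : ι → E} {K D₀ g : ℝ} {M₀ k : ℕ} {ξ η : E}
    (hK : 0 ≤ K) (hg : 0 ≤ g) (hD₀ : 0 ≤ D₀)
    (hξ : ∃ j, ‖ξ‖ ≤ K * |⟪ξ, v j⟫|) (hη : ∃ j, ‖η‖ ≤ K * |⟪η, v j⟫|)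
    (h : ∀ j, ∀ N ≤ 2 * M₀ + k,
      (|⟪ξ, v j⟫| ^ N + |⟪η, v j⟫| ^ N) * g ≤ D₀ * (1 + ‖ξ‖) ^ M₀ * (1 + ‖η‖) ^ M₀) :
    (1 + ‖ξ‖ + ‖η‖) ^ k * g ≤ (1 + 2 * K) ^ (2 * M₀ + k) * D₀ := by
  obtain ⟨j₁, hj₁⟩ := hξ
  obtain ⟨j₂, hj₂⟩ := hη
  set p := |⟪ξ, v j₁⟫| with hp
  set q := |⟪η, v j₂⟫| with hq
  set s := 1 + ‖ξ‖ + ‖η‖ with hs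
  set D := D₀ * (1 + ‖ξ‖) ^ M₀ * (1 + ‖η‖) ^ M₀ with hD
  have hs1 : 1 ≤ s := by rw [hs]; nlinarith [norm_nonneg ξ, norm_nonneg η]
  -- each slot separately
  have hslotξ : ∀ N ≤ 2 * M₀ + k, p ^ N * g ≤ D := fun N hN =>
    le_trans (by nlinarith [pow_nonneg (abs_nonneg ⟪η, v j₁⟫) N]) (h j₁ N hN)
  have hslotη : ∀ N ≤ 2 * M₀ + k, q ^ N * g ≤ D := fun N hN =>
    le_trans (by nlinarith [pow_nonneg (abs_nonneg ⟪ξ, v j₂⟫) N]) (h j₂ N hN)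
  -- the largest generator
  set m := max 1 (max p q) with hm
  have hm1 : 1 ≤ m := le_max_left _ _
  have hpm : p ≤ m := (le_max_left _ _).trans (le_max_right _ _)
  have hqm : q ≤ m := (le_max_right _ _).trans (le_max_right _ _)
  have hsm : s ≤ (1 + 2 * K) * m := by
    calc s = 1 + ‖ξ‖ + ‖η‖ := hs
      _ ≤ m + K * m + K * m := by
          gcongr
          · exact hj₁.trans (mul_le_mul_of_nonneg_left hpm hK)
          · exact hj₂.trans (mul_le_mul_of_nonneg_left hqm hK)
      _ = (1 + 2 * K) * m := by ring
  have hmg : m ^ (2 * M₀ + k) * g ≤ D := by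
    rcases max_choice 1 (max p q) with h1 | h2
    · rw [hm, h1, one_pow, one_mul]
      simpa using hslotξ 0 (Nat.zero_le _)
    · rcases max_choice p q with h3 | h4
      · rw [hm, h2, h3]
        exact hslotξ _ le_rfl
      · rw [hm, h2, h4]
        exact hslotη _ le_rfl
  -- `s^{2M₀+k} g ≤ (1+2K)^{2M₀+k} D ≤ (1+2K)^{2M₀+k} D₀ s^{2M₀}`
  have hD_le : D ≤ D₀ * s ^ (2 * M₀) := by
    have h1 : (1 + ‖ξ‖) ^ M₀ ≤ s ^ M₀ :=
      pow_le_pow_left₀ (by positivity) (by rw [hs]; linarith [norm_nonneg η]) _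
    have h2 : (1 + ‖η‖) ^ M₀ ≤ s ^ M₀ :=
      pow_le_pow_left₀ (by positivity) (by rw [hs]; linarith [norm_nonneg ξ]) _
    calc D = D₀ * ((1 + ‖ξ‖) ^ M₀ * (1 + ‖η‖) ^ M₀) := by rw [hD]; ring
      _ ≤ D₀ * (s ^ M₀ * s ^ M₀) := by gcongr
      _ = D₀ * s ^ (2 * M₀) := by ring
  have hmain : s ^ (2 * M₀ + k) * g ≤ (1 + 2 * K) ^ (2 * M₀ + k) * (D₀ * s ^ (2 * M₀)) := by
    calc s ^ (2 * M₀ + k) * g ≤ ((1 + 2 * K) * m) ^ (2 * M₀ + k) * g := by gcongr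
      _ = (1 + 2 * K) ^ (2 * M₀ + k) * (m ^ (2 * M₀ + k) * g) := by rw [mul_pow]; ring
      _ ≤ (1 + 2 * K) ^ (2 * M₀ + k) * D := by gcongr
      _ ≤ (1 + 2 * K) ^ (2 * M₀ + k) * (D₀ * s ^ (2 * M₀)) := by gcongr
  have hspos : 0 < s ^ (2 * M₀) := by positivity
  rw [pow_add, mul_assoc] at hmain
  rw [show (1 + 2 * K) ^ (2 * M₀ + k) * (D₀ * s ^ (2 * M₀)) =
    s ^ (2 * M₀) * ((1 + 2 * K) ^ (2 * M₀ + k) * D₀) by ring] at hmain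
  exact le_of_mul_le_mul_left hmain hspos

/-- **Smooth cut-offs**: a Schwartz function `χ` with `χ = 1` on `B(x₀, ρ)` and
`supp χ ⊆ B̄(x₀, 2ρ)` (a `ContDiffBump`). [folklore] -/
theorem exists_cutoff_schwartz [FiniteDimensional ℝ E] (x₀ : E) {ρ : ℝ} (hρ : 0 < ρ) :
    ∃ χ : 𝓢(E, ℂ), tsupport (χ : E → ℂ) ⊆ closedBall x₀ (2 * ρ) ∧ ∀ x ∈ ball x₀ ρ, χ x = 1 := by
  let φ : ContDiffBump x₀ := ⟨ρ, 2 * ρ, hρ, by linarith⟩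
  have hφs : HasCompactSupport (fun x => ((φ x : ℝ) : ℂ)) := φ.hasCompactSupport.comp_left Complex.ofReal_zero
  have hφd : ContDiff ℝ ((⊤ : ℕ∞) : WithTop ℕ∞) (fun x => ((φ x : ℝ) : ℂ)) :=
    Complex.ofRealCLM.contDiff.comp φ.contDiff
  refine ⟨hφs.toSchwartzMap hφd, ?_, fun x hx => ?_⟩
  · have h : tsupport (fun x => ((φ x : ℝ) : ℂ)) ⊆ tsupport φ := tsupport_comp_subset Complex.ofReal_zero _
    rw [φ.tsupport_eq] at h
    exact h
  · change ((φ x : ℝ) : ℂ) = 1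
    rw [φ.one_of_mem_closedBall (ball_subset_closedBall hx), Complex.ofReal_one]

end Geometry

/-! ## The flattening `E² ≃ ℝ⁸` -/

section Flatten

/-- Inner products of flattened two-point configurations: `⟪Φx, Φy⟫ = ⟪x₀, y₀⟫ + ⟪x₁, y₁⟫`. [folklore] -/
theorem inner_flattenCLE_two (x y : Fin 2 → EuclideanSpace ℝ (Fin 4)) :
    ⟪flattenCLE 3 2 x, flattenCLE 3 2 y⟫ = ⟪x 0, y 0⟫ + ⟪x 1, y 1⟫ := by
  simp [PiLp.inner_apply, flattenCLE_apply, Fintype.sum_prod_type, Fin.sum_univ_two]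

/-- `‖Φx‖ ≤ ‖x₀‖ + ‖x₁‖` for the flattening `Φ`. [folklore] -/
theorem norm_flattenCLE_two_le (x : Fin 2 → EuclideanSpace ℝ (Fin 4)) :
    ‖flattenCLE 3 2 x‖ ≤ ‖x 0‖ + ‖x 1‖ := by
  have h : ‖flattenCLE 3 2 x‖ ^ 2 ≤ (‖x 0‖ + ‖x 1‖) ^ 2 := by
    rw [← real_inner_self_eq_norm_sq, inner_flattenCLE_two, real_inner_self_eq_norm_sq,
      real_inner_self_eq_norm_sq]
    nlinarith [norm_nonneg (x 0), norm_nonneg (x 1)]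
  exact (pow_le_pow_iff_left₀ (norm_nonneg _) (by positivity) two_ne_zero).1 h

end Flatten

/-! ## The stub -/

/-- **Stub `TensorRegularity`** (A2 of line `sixteen-charts-analytic-kernel`): control of pure
derivatives of all orders `≤ N₁ = 2M₀ + 9` along four spanning directions, separately in each slot
of a tensor test function and with one fixed Schwartz order `M₀`, forces a continuous functional on
`𝓢((ℝ⁴)², ℂ)` to be integration against a continuous bounded kernel near `(x₀, y₀)`; the order
`N₁`, the radius `ρ` and the bound `B` depend only on the data `(v, U, V, x₀, y₀, M₀)`.
Mechanism: the localised Fourier transform `Λ(e_ξ χ₁ ⊗ e_η χ₂)` decays like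
`(1 + ‖ξ‖ + ‖η‖)^{2M₀ − N₁}` (Leibniz + induction on the order, `PlaneWaveTensorDecay`), which is
integrable on `ℝ⁸`, and a tempered distribution whose localisation has integrable Fourier transform
is a continuous kernel (`FourierDecayKernel`; Hörmander, ALPDO I, Thm. 7.1.14 / §8.1). [folklore] -/
theorem TensorRegularity : open Literature.MathematicalPhysics.QuantumLattice Literature.MathematicalPhysics.AQFT Literature.MathematicalPhysics.QuantumFieldTheory in ∀ (v : Fin 4 → (EuclideanSpace ℝ (Fin 4))), LinearIndependent ℝ v → ∀ (U V : Set (EuclideanSpace ℝ (Fin 4))), IsOpen U → IsOpen V → ∀ (x₀ y₀ : (EuclideanSpace ℝ (Fin 4))), x₀ ∈ U → y₀ ∈ V → ∀ M₀ : ℕ, ∃ (N₁ : ℕ) (ρ B : ℝ), 0 < ρ ∧ ∀ Λ : SchwartzMap (Fin 2 → (EuclideanSpace ℝ (Fin 4))) ℂ →L[ℂ] ℂ, (∀ (j : Fin 4) (N : ℕ), N ≤ N₁ → ∀ (f g : SchwartzMap (EuclideanSpace ℝ (Fin 4)) ℂ), tsupport (f : (EuclideanSpace ℝ (Fin 4))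 → ℂ) ⊆ U → tsupport (g : (EuclideanSpace ℝ (Fin 4)) → ℂ) ⊆ V → ∀ F : SchwartzMap (Fin 2 → (EuclideanSpace ℝ (Fin 4))) ℂ, (IsTensorOf F ![((LineDeriv.lineDerivOp (v j) : SchwartzMap (EuclideanSpace ℝ (Fin 4)) ℂ → SchwartzMap (EuclideanSpace ℝ (Fin 4)) ℂ)^[N] f), g] ∨ IsTensorOf F ![f, ((LineDeriv.lineDerivOp (v j) : SchwartzMap (EuclideanSpace ℝ (Fin 4)) ℂ → SchwartzMap (EuclideanSpace ℝ (Fin 4)) ℂ)^[N] g)]) → ‖Λ F‖ ≤ schwartzNorm M₀ f * schwartzNorm M₀ g) → ∃ K₂ : (Fin 2 → (EuclideanSpace ℝ (Fin 4))) → ℂ, ContinuousOn K₂ {x : Fin 2 → (EuclideanSpace ℝ (Fin 4)) | x 0 ∈ Metric.ball x₀ ρ ∧ x 1 ∈ Metric.ball y₀ ρ} ∧ (∀ x : Fin 2 → (EuclideanSpace ℝ (Fin 4)), x 0 ∈ Metric.ball x₀ ρ → x 1 ∈ Metric.ball y₀ ρ → ‖K₂ x‖ ≤ B) ∧ ∀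 F : SchwartzMap (Fin 2 → (EuclideanSpace ℝ (Fin 4))) ℂ, tsupport (F : (Fin 2 → (EuclideanSpace ℝ (Fin 4))) → ℂ) ⊆ {x : Fin 2 → (EuclideanSpace ℝ (Fin 4)) | x 0 ∈ Metric.ball x₀ ρ ∧ x 1 ∈ Metric.ball y₀ ρ} → MeasureTheory.Integrable (fun x : Fin 2 → (EuclideanSpace ℝ (Fin 4)) => K₂ x * F x) ∧ Λ F = ∫ x : Fin 2 → (EuclideanSpace ℝ (Fin 4)), K₂ x * F x := by
  intro v hv U V hU hV x₀ y₀ hx₀ hy₀ M₀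
  -- Step 0: the radius and the cut-offs
  obtain ⟨εU, hεU, hεU'⟩ := Metric.isOpen_iff.1 hU x₀ hx₀
  obtain ⟨εV, hεV, hεV'⟩ := Metric.isOpen_iff.1 hV y₀ hy₀
  set ρ : ℝ := min εU εV / 3 with hρdef
  have hρ : 0 < ρ := by positivity
  have hρU : closedBall x₀ (2 * ρ) ⊆ U :=
    (closedBall_subset_ball (by
      have := min_le_left εU εV
      rw [hρdef]; linarith)).trans hεU'
  have hρV : closedBall y₀ (2 * ρ) ⊆ V :=
    (closedBall_subset_ball (by
      have := min_le_right εU εV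
      rw [hρdef]; linarith)).trans hεV'
  obtain ⟨χ₁, hχ₁s, hχ₁1⟩ := exists_cutoff_schwartz x₀ hρ
  obtain ⟨χ₂, hχ₂s, hχ₂1⟩ := exists_cutoff_schwartz y₀ hρ
  have hχ₁U : tsupport (χ₁ : EuclideanSpace ℝ (Fin 4) → ℂ) ⊆ U := hχ₁s.trans hρU
  have hχ₂V : tsupport (χ₂ : EuclideanSpace ℝ (Fin 4) → ℂ) ⊆ V := hχ₂s.trans hρV
  -- the spanning constant
  obtain ⟨K, hK0, hK⟩ := exists_norm_le_mul_abs_inner hv (by simp)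
  -- orders and constants
  set N₁ : ℕ := 2 * M₀ + 9 with hN₁
  set S₁ : ℝ := ∑ j : Fin 4, ∑ m ∈ Finset.range (N₁ + 1), schwartzNorm M₀
    ((LineDeriv.lineDerivOp (v j) : 𝓢(EuclideanSpace ℝ (Fin 4), ℂ) → 𝓢(EuclideanSpace ℝ (Fin 4), ℂ))^[m] χ₁) with hS₁def
  set S₂ : ℝ := ∑ j : Fin 4, ∑ m ∈ Finset.range (N₁ + 1), schwartzNorm M₀
    ((LineDeriv.lineDerivOp (v j) : 𝓢(EuclideanSpace ℝ (Fin 4), ℂ) → 𝓢(EuclideanSpace ℝ (Fin 4), ℂ))^[m] χ₂) with hS₂def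
  have hS₁ : ∀ j, ∀ m ≤ N₁, schwartzNorm M₀ ((LineDeriv.lineDerivOp (v j) :
      𝓢(EuclideanSpace ℝ (Fin 4), ℂ) → 𝓢(EuclideanSpace ℝ (Fin 4), ℂ))^[m] χ₁) ≤ S₁ := by
    intro j m hm
    calc _ ≤ ∑ m' ∈ Finset.range (N₁ + 1), schwartzNorm M₀ ((LineDeriv.lineDerivOp (v j) :
          𝓢(EuclideanSpace ℝ (Fin 4), ℂ) → 𝓢(EuclideanSpace ℝ (Fin 4), ℂ))^[m'] χ₁) :=
          Finset.single_le_sum (f := fun m' => schwartzNorm M₀ ((LineDeriv.lineDerivOp (v j) :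
            𝓢(EuclideanSpace ℝ (Fin 4), ℂ) → 𝓢(EuclideanSpace ℝ (Fin 4), ℂ))^[m'] χ₁))
            (fun _ _ => schwartzNorm_nonneg _ _) (Finset.mem_range.2 (Nat.lt_succ_of_le hm))
      _ ≤ S₁ := Finset.single_le_sum (f := fun j' => ∑ m' ∈ Finset.range (N₁ + 1), schwartzNorm M₀
            ((LineDeriv.lineDerivOp (v j') : 𝓢(EuclideanSpace ℝ (Fin 4), ℂ) → 𝓢(EuclideanSpace ℝ (Fin 4), ℂ))^[m'] χ₁))
            (fun _ _ => Finset.sum_nonneg fun _ _ => schwartzNorm_nonneg _ _) (Finset.mem_univ j)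
  have hS₂ : ∀ j, ∀ m ≤ N₁, schwartzNorm M₀ ((LineDeriv.lineDerivOp (v j) :
      𝓢(EuclideanSpace ℝ (Fin 4), ℂ) → 𝓢(EuclideanSpace ℝ (Fin 4), ℂ))^[m] χ₂) ≤ S₂ := by
    intro j m hm
    calc _ ≤ ∑ m' ∈ Finset.range (N₁ + 1), schwartzNorm M₀ ((LineDeriv.lineDerivOp (v j) :
          𝓢(EuclideanSpace ℝ (Fin 4), ℂ) → 𝓢(EuclideanSpace ℝ (Fin 4), ℂ))^[m'] χ₂) :=
          Finset.single_le_sum (f := fun m' => schwartzNorm M₀ ((LineDeriv.lineDerivOp (v j) :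
            𝓢(EuclideanSpace ℝ (Fin 4), ℂ) → 𝓢(EuclideanSpace ℝ (Fin 4), ℂ))^[m'] χ₂))
            (fun _ _ => schwartzNorm_nonneg _ _) (Finset.mem_range.2 (Nat.lt_succ_of_le hm))
      _ ≤ S₂ := Finset.single_le_sum (f := fun j' => ∑ m' ∈ Finset.range (N₁ + 1), schwartzNorm M₀
            ((LineDeriv.lineDerivOp (v j') : 𝓢(EuclideanSpace ℝ (Fin 4), ℂ) → 𝓢(EuclideanSpace ℝ (Fin 4), ℂ))^[m'] χ₂))
            (fun _ _ => Finset.sum_nonneg fun _ _ => schwartzNorm_nonneg _ _) (Finset.mem_univ j)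
  have hS₁0 : 0 ≤ S₁ := (schwartzNorm_nonneg _ _).trans (hS₁ 0 0 (Nat.zero_le _))
  have hS₂0 : 0 ≤ S₂ := (schwartzNorm_nonneg _ _).trans (hS₂ 0 0 (Nat.zero_le _))
  set D₀ : ℝ := 2 * ((2 * π) ^ M₀ * S₁ * ((2 * π) ^ M₀ * S₂)) with hD₀
  have hD₀0 : 0 ≤ D₀ := by positivity
  set A : ℝ := (1 + 2 * K) ^ (2 * M₀ + 9) * D₀ with hA
  have hA0 : 0 ≤ A := by positivity
  -- the flattening and the integrable majorant on `ℝ⁸`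
  set Φ : (Fin 2 → EuclideanSpace ℝ (Fin 4)) ≃L[ℝ] EuclideanSpace ℝ (Fin 2 × Fin 4) := flattenCLE 3 2 with hΦ
  set b : EuclideanSpace ℝ (Fin 2 × Fin 4) → ℝ := fun a => A * ((1 + ‖a‖) ^ 9)⁻¹ with hb
  have hbi : Integrable b := by
    have h9 : (Module.finrank ℝ (EuclideanSpace ℝ (Fin 2 × Fin 4)) : ℝ) < 9 := by simp; norm_num
    have h := (integrable_one_add_norm (μ := (volume : Measure (EuclideanSpace ℝ (Fin 2 × Fin 4)))) h9).const_mul A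
    refine h.congr (Eventually.of_forall fun a => ?_)
    simp only [hb]
    rw [Real.rpow_neg (by positivity), show (9 : ℝ) = ((9 : ℕ) : ℝ) by norm_num, Real.rpow_natCast]
  refine ⟨N₁, ρ, ∫ a, b a, hρ, fun Λ hΛ => ?_⟩
  -- the slot bounds supplied by the hypothesis
  have hΛ0 : ∀ j, ∀ N ≤ N₁, ∀ f g : 𝓢(EuclideanSpace ℝ (Fin 4), ℂ),
      tsupport (f : EuclideanSpace ℝ (Fin 4) → ℂ) ⊆ U → tsupport (g : EuclideanSpace ℝ (Fin 4) → ℂ) ⊆ V →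
      ‖Λ (SchwartzMap.tensorFin 2 ![(LineDeriv.lineDerivOp (v j) :
        𝓢(EuclideanSpace ℝ (Fin 4), ℂ) → 𝓢(EuclideanSpace ℝ (Fin 4), ℂ))^[N] f, g])‖ ≤
        schwartzNorm M₀ f * schwartzNorm M₀ g :=
    fun j N hN f g hf hg => hΛ j N hN f g hf hg _ (Or.inl (isTensorOf_tensorFin _))
  have hΛ1 : ∀ j, ∀ N ≤ N₁, ∀ f g : 𝓢(EuclideanSpace ℝ (Fin 4), ℂ),
      tsupport (f : EuclideanSpace ℝ (Fin 4) → ℂ) ⊆ U → tsupport (g : EuclideanSpace ℝ (Fin 4) → ℂ) ⊆ V →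
      ‖Λ (SchwartzMap.tensorFin 2 ![f, (LineDeriv.lineDerivOp (v j) :
        𝓢(EuclideanSpace ℝ (Fin 4), ℂ) → 𝓢(EuclideanSpace ℝ (Fin 4), ℂ))^[N] g])‖ ≤
        schwartzNorm M₀ f * schwartzNorm M₀ g :=
    fun j N hN f g hf hg => hΛ j N hN f g hf hg _ (Or.inr (isTensorOf_tensorFin _))
  -- the functional and the cut-off on the flattened space
  set T : 𝓢(EuclideanSpace ℝ (Fin 2 × Fin 4), ℂ) →L[ℂ] ℂ :=
    Λ.comp (SchwartzMap.compCLMOfContinuousLinearEquiv ℂ Φ) with hT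
  set χ' : 𝓢(EuclideanSpace ℝ (Fin 2 × Fin 4), ℂ) :=
    SchwartzMap.compCLMOfContinuousLinearEquiv ℂ Φ.symm (SchwartzMap.tensorFin 2 ![χ₁, χ₂]) with hχ'
  have hχ'x : ∀ x : Fin 2 → EuclideanSpace ℝ (Fin 4), χ' (Φ x) = χ₁ (x 0) * χ₂ (x 1) := fun x => by
    rw [hχ', SchwartzMap.compCLMOfContinuousLinearEquiv_apply, Function.comp_apply, Φ.symm_apply_apply,
      tensorFin_two_eval]
  -- decay of the plane-wave values of `χ'T`
  have hdecay : ∀ (a : EuclideanSpace ℝ (Fin 2 × Fin 4)) (ψ : 𝓢(EuclideanSpace ℝ (Fin 2 × Fin 4), ℂ)),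
      (∀ q, ψ q = (𝐞 (-⟪a, q⟫) : ℂ) * χ' q) → ‖T ψ‖ ≤ b a := by
    intro a ψ hψ
    set ξ : EuclideanSpace ℝ (Fin 4) := Φ.symm a 0 with hξ
    set η : EuclideanSpace ℝ (Fin 4) := Φ.symm a 1 with hη
    have hTψ : T ψ = Λ (SchwartzMap.tensorFin 2
        ![SchwartzMap.smulLeftCLM ℂ (fun y : EuclideanSpace ℝ (Fin 4) => (𝐞 (-⟪ξ, y⟫) : ℂ)) χ₁,
          SchwartzMap.smulLeftCLM ℂ (fun y : EuclideanSpace ℝ (Fin 4) => (𝐞 (-⟪η, y⟫) : ℂ)) χ₂]) := by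
      rw [hT, ContinuousLinearMap.comp_apply]
      congr 1
      ext x
      have ha : ⟪a, Φ x⟫ = ⟪ξ, x 0⟫ + ⟪η, x 1⟫ := by
        conv_lhs => rw [← Φ.apply_symm_apply a]
        rw [hΦ, inner_flattenCLE_two]
      rw [SchwartzMap.compCLMOfContinuousLinearEquiv_apply, Function.comp_apply, hψ, tensorFin_two_eval,
        smulLeftCLM_fourierChar_apply, smulLeftCLM_fourierChar_apply, hχ'x, ha, neg_add,
        AddChar.map_add_eq_mul, Circle.coe_mul]
      ring
    set g : ℝ := ‖Λ (SchwartzMap.tensorFin 2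
        ![SchwartzMap.smulLeftCLM ℂ (fun y : EuclideanSpace ℝ (Fin 4) => (𝐞 (-⟪ξ, y⟫) : ℂ)) χ₁,
          SchwartzMap.smulLeftCLM ℂ (fun y : EuclideanSpace ℝ (Fin 4) => (𝐞 (-⟪η, y⟫) : ℂ)) χ₂])‖ with hg
    have key : ∀ j, ∀ N ≤ 2 * M₀ + 9, (|⟪ξ, v j⟫| ^ N + |⟪η, v j⟫| ^ N) * g ≤
        D₀ * (1 + ‖ξ‖) ^ M₀ * (1 + ‖η‖) ^ M₀ := by
      intro j N hN
      refine (abs_inner_pow_mul_norm_tensor_le Λ (hΛ0 j) (hΛ1 j) hχ₁U hχ₂V (hS₁ j) (hS₂ j) ξ η hN).trans ?_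
      rw [hD₀]
      exact le_of_eq (by ring)
    have hcomb := pow_mul_le_of_slot_bounds (k := 9) hK0 (norm_nonneg _) hD₀0 (hK ξ) (hK η) key
    have hna : ‖a‖ ≤ ‖ξ‖ + ‖η‖ := by
      have h := norm_flattenCLE_two_le (Φ.symm a)
      rw [← hΦ] at h
      rwa [Φ.apply_symm_apply] at h
    have hs : 0 < 1 + ‖ξ‖ + ‖η‖ := by positivity
    change ‖T ψ‖ ≤ A * ((1 + ‖a‖) ^ 9)⁻¹
    rw [hTψ]
    change g ≤ A * ((1 + ‖a‖) ^ 9)⁻¹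
    calc g ≤ A * ((1 + ‖ξ‖ + ‖η‖) ^ 9)⁻¹ := by
          rw [← div_eq_mul_inv, le_div_iff₀ (pow_pos hs 9), mul_comm]
          exact hcomb
      _ ≤ A * ((1 + ‖a‖) ^ 9)⁻¹ := by
          refine mul_le_mul_of_nonneg_left (inv_anti₀ (pow_pos (by positivity) 9) ?_) hA0
          exact pow_le_pow_left₀ (by positivity) (by linarith) 9
  -- the kernel on the flattened space
  obtain ⟨K', hK'c, hK'b, hK'rep⟩ := exists_kernel_of_planeWave_bound T χ' hbi hdecay
  refine ⟨fun x => K' (Φ x), (hK'c.comp Φ.continuous).continuousOn, fun x _ _ => hK'b (Φ x), fun F hF => ?_⟩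
  -- representation for `F` supported in the chart
  set G : 𝓢(EuclideanSpace ℝ (Fin 2 × Fin 4), ℂ) := SchwartzMap.compCLMOfContinuousLinearEquiv ℂ Φ.symm F with hG
  have hFG : F = SchwartzMap.compCLMOfContinuousLinearEquiv ℂ Φ
      (SchwartzMap.smulLeftCLM ℂ (χ' : EuclideanSpace ℝ (Fin 2 × Fin 4) → ℂ) G) := by
    ext x
    rw [SchwartzMap.compCLMOfContinuousLinearEquiv_apply, Function.comp_apply,
      SchwartzMap.smulLeftCLM_apply_apply χ'.hasTemperateGrowth, smul_eq_mul, hχ'x, hG,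
      SchwartzMap.compCLMOfContinuousLinearEquiv_apply, Function.comp_apply, Φ.symm_apply_apply]
    by_cases hx : x ∈ tsupport (F : (Fin 2 → EuclideanSpace ℝ (Fin 4)) → ℂ)
    · obtain ⟨h0, h1⟩ := hF hx
      rw [hχ₁1 _ h0, hχ₂1 _ h1]
      ring
    · rw [image_eq_zero_of_notMem_tsupport hx]
      ring
  obtain ⟨hint, hrep⟩ := hK'rep G
  have hΛF : Λ F = T (SchwartzMap.smulLeftCLM ℂ (χ' : EuclideanSpace ℝ (Fin 2 × Fin 4) → ℂ) G) := by
    rw [hT, ContinuousLinearMap.comp_apply, ← hFG]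
  have hcov : ∫ x : Fin 2 → EuclideanSpace ℝ (Fin 4), K' (Φ x) * F x = ∫ q, K' q * G q := by
    have h := integral_comp_flattenCLE (d := 3) (n := 2) (fun q => K' q * G q)
    refine Eq.trans (integral_congr_ae (Eventually.of_forall fun x => ?_)) h
    simp only [hG, SchwartzMap.compCLMOfContinuousLinearEquiv_apply, Function.comp_apply, hΦ,
      ContinuousLinearEquiv.symm_apply_apply]
  refine ⟨?_, ?_⟩
  · haveI : (volume : Measure (Fin 2 → EuclideanSpace ℝ (Fin 4))).HasTemperateGrowth :=
      Measure.IsAddHaarMeasure.instHasTemperateGrowth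
    exact F.integrable.bdd_mul (hK'c.comp Φ.continuous).aestronglyMeasurable
      (Eventually.of_forall fun x => hK'b (Φ x))
  · rw [hΛF, hrep, hcov]

end Summit.QuantumFields.YangMills.Theorems.CurvatureKernel
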